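import Literature.NumberTheory.LFunctions.WeilExplicit
import Literature.NumberTheory.LFunctions.WeilExplicitProofs
import Literature.NumberTheory.LFunctions.WeilMellinBounds
import Literature.NumberTheory.LFunctions.WeilMellinInversion
import Literature.NumberTheory.LFunctions.WeilArchimedeanPositivityProofs
import Literature.NumberTheory.LFunctions.WeilArchimedeanMoments
import Literature.Analysis.SpecialFunctions.DigammaVerticalSeries

/-!
# Stub `stub_spectralArchPolar` for crux `SignCone.SignConeOscillatory` (stmt-RiemannHypothesis-16302), line Sketch

Yoshida-form bookkeeping of the archimedean-plus-polar part `W_ar = weilPolarTerm + weilArchTerm`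
of Weil's functional on one autocorrelation `k = g ⋆ g̃` (`g̃(t) = conj g(-t)`), in the
normalisation of `Literature.NumberTheory.LFunctions.WeilExplicit`
(`ĝ(s) = weilMellin g s = ∫ g(t) e^{(s - 1/2)t} dt`, so that `ĝ(1/2 + iy)` is the Fourier
transform of `g` and `k̂(1/2 + iy) = |ĝ(1/2 + iy)|²`).

Given the polar–node–zeta identity for `k` on the critical line (hypotheses of the stub),
`∫ k̂(1/2+iy) ζ(1/2+iy) dy = 2π Σ_{1 ≤ n ≤ N} k(log n)/√n - 2π k̂(1)`, we prove
`Re W_ar(k) + ‖g‖₂² = -(1/2π) ∫ |ĝ(1/2+iy)|² J_N(y) dy` with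
`J_N(y) = 2 Re(ζ - ζ_N)(1/2+iy) - Re ψ(1/4 + iy/2) + log π - 1`, `ζ_N(s) = Σ_{n ≤ N} n^{-s}`.

Ingredients (all in the tree): `Re polar(k) = 2 Re k̂(1)` (`weilMellin_weilQuadratic`),
`k̂(1/2+iy) = |ĝ(1/2+iy)|²` (`weilMellin_weilConv_weilReflect_half`), the node values
`∫ k̂(1/2+iy) n^{-(1/2+iy)} dy = 2π k(log n)/√n` (`integral_weilMellin_vertical_mul_natCast_cpow`),
the archimedean integral `weilArchIntegral_weilConv_weilReflect`, `k(0) = ‖g‖₂²`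
(`weilConv_weilReflect_apply_zero`) and Plancherel `∫ |ĝ(1/2+iy)|² dy = 2π ‖g‖₂²`
(`integral_norm_sq_weilMellin_half_line`).
-/

noncomputable section
set_option linter.dupNamespace false
open scoped BigOperators ComplexConjugate Real
open Complex MeasureTheory Set Filter

namespace Summit.RiemannHypothesis.RiemannHypothesis.Theorems.SignConeOscillatory

open Literature.NumberTheory.LFunctions

/-- `Re (2π z) = 2π Re z`. -/
theorem re_two_pi_mul (z : ℂ) : (2 * (π : ℂ) * z).re = 2 * π * z.re := by
  rw [show (2 : ℂ) * (π : ℂ) = ((2 * π : ℝ) : ℂ) by push_cast; ring, Complex.re_ofReal_mul]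

/-- **Node pairing on the critical line.** For a Weil test `k` and `n ≥ 1`,
`y ↦ k̂(1/2+iy) n^{-(1/2+iy)}` is integrable and `∫ k̂(1/2+iy) n^{-(1/2+iy)} dy = 2π k(log n)/√n`
(`integral_weilMellin_vertical_mul_natCast_cpow` at `c = 1/2`). -/
theorem node_pairing_half {k : ℝ → ℂ} (hk : IsWeilTest k) {n : ℕ} (hn : n ≠ 0) :
    Integrable (fun y : ℝ => weilMellin k (1 / 2 + y * I) * (n : ℂ) ^ (-(1 / 2 + y * I))) ∧
    ∫ y : ℝ, weilMellin k (1 / 2 + y * I) * (n : ℂ) ^ (-(1 / 2 + y * I))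
      = 2 * π * (k (Real.log n) / (Real.sqrt n : ℂ)) := by
  have hhalf : ((1 / 2 : ℝ) : ℂ) = 1 / 2 := by push_cast; ring
  constructor
  · have h := integrable_weilMellin_vertical_mul hk (1 / 2)
      (F := fun y : ℝ => (n : ℂ) ^ (-(1 / 2 + y * I))) ?_ (B := 1) ?_
    · simpa only [hhalf] using h
    · exact Continuous.const_cpow (by fun_prop) (Or.inl (by exact_mod_cast hn))
    · intro y
      rw [Complex.norm_natCast_cpow_of_pos (Nat.pos_of_ne_zero hn)]
      simp only [neg_re, add_re, one_div, inv_re, re_ofNat, normSq_ofNat, mul_re, ofReal_re, I_re,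
        mul_zero, ofReal_im, I_im, mul_one, sub_self, add_zero]
      exact Real.rpow_le_one_of_one_le_of_nonpos (by exact_mod_cast Nat.pos_of_ne_zero hn)
        (by norm_num)
  · have h := integral_weilMellin_vertical_mul_natCast_cpow hk (1 / 2) hn
    simpa only [hhalf] using h

/-- **Node pairing on an autocorrelation, real form.** For a Weil test `g`, `k = g ⋆ g̃` and
`n ≥ 1`: `y ↦ |ĝ(1/2+iy)|² Re n^{-(1/2+iy)}` is integrable and
`∫ |ĝ(1/2+iy)|² Re n^{-(1/2+iy)} dy = 2π Re (k(log n)/√n)` (`k̂(1/2+iy) = |ĝ(1/2+iy)|²`). -/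
theorem node_pairing_normSq {g : ℝ → ℂ} (hg : IsWeilTest g) {n : ℕ} (hn : n ≠ 0) :
    Integrable (fun y : ℝ => ‖weilMellin g (1 / 2 + y * I)‖ ^ 2 *
        ((n : ℂ) ^ (-(1 / 2 + y * I))).re) ∧
    ∫ y : ℝ, ‖weilMellin g (1 / 2 + y * I)‖ ^ 2 * ((n : ℂ) ^ (-(1 / 2 + y * I))).re
      = 2 * π * (weilConv g (weilReflect g) (Real.log n) / (Real.sqrt n : ℂ)).re := by
  obtain ⟨hI, hv⟩ := node_pairing_half (hg.weilConv hg.weilReflect) hn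
  have he : ∀ y : ℝ, ‖weilMellin g (1 / 2 + y * I)‖ ^ 2 * ((n : ℂ) ^ (-(1 / 2 + y * I))).re
      = (weilMellin (weilConv g (weilReflect g)) (1 / 2 + y * I) *
          (n : ℂ) ^ (-(1 / 2 + y * I))).re := by
    intro y
    rw [weilMellin_weilConv_weilReflect_half hg y, Complex.re_ofReal_mul]
  constructor
  · have h := hI.re
    simp only [RCLike.re_to_complex] at h
    exact h.congr (Eventually.of_forall fun y => (he y).symm)
  · have h := integral_re hI
    simp only [RCLike.re_to_complex] at h
    have hc : ∫ y : ℝ, ‖weilMellin g (1 / 2 + y * I)‖ ^ 2 * ((n : ℂ) ^ (-(1 / 2 + y * I))).re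
        = ∫ y : ℝ, (weilMellin (weilConv g (weilReflect g)) (1 / 2 + y * I) *
            (n : ℂ) ^ (-(1 / 2 + y * I))).re :=
      integral_congr_ae (Eventually.of_forall he)
    rw [hc, h, hv, re_two_pi_mul]

/-- **The truncated Dirichlet polynomial pairs to the node sum.** For a Weil test `g`,
`k = g ⋆ g̃` and `ζ_N(s) = Σ_{1 ≤ n ≤ N} n^{-s}`: `y ↦ |ĝ(1/2+iy)|² Re ζ_N(1/2+iy)` is integrable and
`∫ |ĝ(1/2+iy)|² Re ζ_N(1/2+iy) dy = 2π Re Σ_{1 ≤ n ≤ N} k(log n)/√n`. -/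
theorem sum_pairing_normSq {g : ℝ → ℂ} (hg : IsWeilTest g) (N : ℕ) :
    Integrable (fun y : ℝ => ‖weilMellin g (1 / 2 + y * I)‖ ^ 2 *
        (∑ n ∈ Finset.Icc 1 N, (n : ℂ) ^ (-(1 / 2 + y * I))).re) ∧
    ∫ y : ℝ, ‖weilMellin g (1 / 2 + y * I)‖ ^ 2 *
        (∑ n ∈ Finset.Icc 1 N, (n : ℂ) ^ (-(1 / 2 + y * I))).re
      = 2 * π * (∑ n ∈ Finset.Icc 1 N,
          weilConv g (weilReflect g) (Real.log n) / (Real.sqrt n : ℂ)).re := by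
  have hne : ∀ n ∈ Finset.Icc 1 N, n ≠ 0 := fun n hn =>
    Nat.one_le_iff_ne_zero.1 (Finset.mem_Icc.1 hn).1
  have he : (fun y : ℝ => ‖weilMellin g (1 / 2 + y * I)‖ ^ 2 *
        (∑ n ∈ Finset.Icc 1 N, (n : ℂ) ^ (-(1 / 2 + y * I))).re) =
      fun y : ℝ => ∑ n ∈ Finset.Icc 1 N,
        ‖weilMellin g (1 / 2 + y * I)‖ ^ 2 * ((n : ℂ) ^ (-(1 / 2 + y * I))).re := by
    funext y
    rw [Complex.re_sum, Finset.mul_sum]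
  rw [he]
  refine ⟨integrable_finsetSum _ fun n hn => (node_pairing_normSq hg (hne n hn)).1, ?_⟩
  rw [integral_finsetSum _ fun n hn => (node_pairing_normSq hg (hne n hn)).1,
    Complex.re_sum, Finset.mul_sum]
  exact Finset.sum_congr rfl fun n hn => (node_pairing_normSq hg (hne n hn)).2

/-- **Zeta pairing in real form.** If `k̂(1/2+iy) ζ(1/2+iy)` is integrable (`k = g ⋆ g̃`), then so
is `|ĝ(1/2+iy)|² Re ζ(1/2+iy)` and `∫ |ĝ(1/2+iy)|² Re ζ(1/2+iy) dy = Re ∫ k̂(1/2+iy) ζ(1/2+iy) dy`. -/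
theorem zeta_pairing_normSq {g : ℝ → ℂ} (hg : IsWeilTest g)
    (hInt : Integrable (fun y : ℝ => weilMellin (weilConv g (weilReflect g)) (1 / 2 + y * I) *
        riemannZeta (1 / 2 + y * I))) :
    Integrable (fun y : ℝ => ‖weilMellin g (1 / 2 + y * I)‖ ^ 2 *
        (riemannZeta (1 / 2 + y * I)).re) ∧
    ∫ y : ℝ, ‖weilMellin g (1 / 2 + y * I)‖ ^ 2 * (riemannZeta (1 / 2 + y * I)).re
      = (∫ y : ℝ, weilMellin (weilConv g (weilReflect g)) (1 / 2 + y * I) *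
          riemannZeta (1 / 2 + y * I)).re := by
  have he : ∀ y : ℝ, ‖weilMellin g (1 / 2 + y * I)‖ ^ 2 * (riemannZeta (1 / 2 + y * I)).re
      = (weilMellin (weilConv g (weilReflect g)) (1 / 2 + y * I) *
          riemannZeta (1 / 2 + y * I)).re := by
    intro y
    rw [weilMellin_weilConv_weilReflect_half hg y, Complex.re_ofReal_mul]
  constructor
  · have h := hInt.re
    simp only [RCLike.re_to_complex] at h
    exact h.congr (Eventually.of_forall fun y => (he y).symm)
  · have h := integral_re hInt
    simp only [RCLike.re_to_complex] at h
    have hc : ∫ y : ℝ, ‖weilMellin g (1 / 2 + y * I)‖ ^ 2 * (riemannZeta (1 / 2 + y * I)).re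
        = ∫ y : ℝ, (weilMellin (weilConv g (weilReflect g)) (1 / 2 + y * I) *
            riemannZeta (1 / 2 + y * I)).re :=
      integral_congr_ae (Eventually.of_forall he)
    rw [hc, h]

/-- **Polar term of an autocorrelation.** `Re (k̂(0) + k̂(1)) = 2 Re k̂(1)` for `k = g ⋆ g̃`, since
`k̂(0) = ĝ(0) conj ĝ(1) = conj k̂(1)` (`weilMellin_weilQuadratic`). -/
theorem weilPolarTerm_autocorr_re {g : ℝ → ℂ} (hg : IsWeilTest g) :
    (weilPolarTerm (weilConv g (weilReflect g))).re =
      2 * (weilMellin (weilConv g (weilReflect g)) 1).re := by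
  unfold weilPolarTerm
  rw [Complex.add_re, weilMellin_weilQuadratic hg 0, weilMellin_weilQuadratic hg 1]
  simp only [map_one, sub_self, map_zero, sub_zero]
  simp only [Complex.mul_re, Complex.conj_re, Complex.conj_im]
  ring

/-- **Archimedean term of an autocorrelation, real part.**
`Re W_∞(k) = (1/2π) ∫ |ĝ(1/2+it)|² Re ψ(1/4 + it/2) dt - ‖g‖₂² log π` for `k = g ⋆ g̃`
(`weilArchIntegral_weilConv_weilReflect`, `weilConv_weilReflect_apply_zero`). -/
theorem weilArchTerm_autocorr_re {g : ℝ → ℂ} (hg : IsWeilTest g) :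
    (weilArchTerm (weilConv g (weilReflect g))).re =
      1 / (2 * π) * (∫ t : ℝ, ‖weilMellin g (1 / 2 + t * I)‖ ^ 2 *
          (Complex.digamma (1 / 4 + t / 2 * I)).re) - (∫ t : ℝ, ‖g t‖ ^ 2) * Real.log π := by
  unfold weilArchTerm
  rw [weilArchIntegral_weilConv_weilReflect hg, weilConv_weilReflect_apply_zero,
    show (1 / (2 * π) : ℂ) = ((1 / (2 * π) : ℝ) : ℂ) by push_cast; ring,
    Complex.sub_re, Complex.re_ofReal_mul, Complex.ofReal_re, Complex.re_ofReal_mul,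
    Complex.ofReal_re]

/-- STUB `stub_spectralArchPolar` (spectral form of `W_ar` on one autocorrelation, Yoshida-form
bookkeeping). Given the polar–node–zeta identity for `k = g ⋆ g̃` (hypotheses),
`Re W_ar(k) + ‖g‖₂² = -(1/2π) ∫ |ĝ(1/2+iy)|² J_N(y) dy` with
`J_N(y) = 2 Re(ζ - ζ_N)(1/2+iy) - Re ψ(1/4 + iy/2) + log π - 1`:
`Re polar(k) = 2 Re k̂(1)` (`weilPolarTerm_autocorr_re`), `k̂(1/2+iy) = |ĝ(1/2+iy)|²`
(`weilMellin_weilConv_weilReflect_half`), nodes by `integral_weilMellin_vertical_mul_natCast_cpow`,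
`‖g‖₂² = (1/2π) ∫ |ĝ(1/2+iy)|² dy` (`integral_norm_sq_weilMellin_half_line`), arch by
`weilArchIntegral_weilConv_weilReflect`. -/
theorem stub_spectralArchPolar :
    ∀ (g : ℝ → ℂ) (N : ℕ), 1 ≤ N → IsWeilTest g →
      Integrable (fun y : ℝ => weilMellin (weilConv g (weilReflect g)) (1 / 2 + y * I) *
          riemannZeta (1 / 2 + y * I)) →
      (∫ y : ℝ, weilMellin (weilConv g (weilReflect g)) (1 / 2 + y * I) * riemannZeta (1 / 2 + y * I))
          = 2 * π * (∑ n ∈ Finset.Icc 1 N,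
              weilConv g (weilReflect g) (Real.log n) / (Real.sqrt n : ℂ))
            - 2 * π * weilMellin (weilConv g (weilReflect g)) 1 →
      (weilPolarTerm (weilConv g (weilReflect g)) + weilArchTerm (weilConv g (weilReflect g))).re
          + (∫ t : ℝ, ‖g t‖ ^ 2)
        = -(1 / (2 * π)) * ∫ y : ℝ, ‖weilMellin g (1 / 2 + y * I)‖ ^ 2 *
            (2 * (riemannZeta (1 / 2 + y * I)
                    - ∑ n ∈ Finset.Icc 1 N, (n : ℂ) ^ (-(1 / 2 + y * I))).re
              - (Complex.digamma (1 / 4 + y / 2 * I)).re + Real.log π - 1) := by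
  intro g N _hN hg hInt hP
  -- the four real pairings and Plancherel
  obtain ⟨hZi, hZv⟩ := zeta_pairing_normSq hg hInt
  obtain ⟨hSi, hSv⟩ := sum_pairing_normSq hg N
  have hDi : Integrable fun y : ℝ => ‖weilMellin g (1 / 2 + y * I)‖ ^ 2 *
      (Complex.digamma (1 / 4 + y / 2 * I)).re :=
    integrable_norm_sq_weilMellin_mul_reDigammaQuarter hg
  have hAi : Integrable fun y : ℝ => ‖weilMellin g (1 / 2 + y * I)‖ ^ 2 :=
    integrable_norm_sq_weilMellin_half_line hg
  have hPl : ∫ y : ℝ, ‖weilMellin g (1 / 2 + y * I)‖ ^ 2 = 2 * π * ∫ t : ℝ, ‖g t‖ ^ 2 :=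
    integral_norm_sq_weilMellin_half_line hg
  -- the polar–node–zeta identity, real part
  have hPre := congrArg Complex.re hP
  rw [Complex.sub_re, re_two_pi_mul, re_two_pi_mul] at hPre
  -- split the right-hand integral
  have e : ∀ y : ℝ, ‖weilMellin g (1 / 2 + y * I)‖ ^ 2 *
      (2 * (riemannZeta (1 / 2 + y * I)
            - ∑ n ∈ Finset.Icc 1 N, (n : ℂ) ^ (-(1 / 2 + y * I))).re
        - (Complex.digamma (1 / 4 + y / 2 * I)).re + Real.log π - 1)
      = 2 * (‖weilMellin g (1 / 2 + y * I)‖ ^ 2 * (riemannZeta (1 / 2 + y * I)).re)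
        - 2 * (‖weilMellin g (1 / 2 + y * I)‖ ^ 2 *
            (∑ n ∈ Finset.Icc 1 N, (n : ℂ) ^ (-(1 / 2 + y * I))).re)
        - ‖weilMellin g (1 / 2 + y * I)‖ ^ 2 * (Complex.digamma (1 / 4 + y / 2 * I)).re
        + (Real.log π - 1) * ‖weilMellin g (1 / 2 + y * I)‖ ^ 2 := by
    intro y
    rw [Complex.sub_re]
    ring
  have h1 : Integrable fun y : ℝ =>
      2 * (‖weilMellin g (1 / 2 + y * I)‖ ^ 2 * (riemannZeta (1 / 2 + y * I)).re) :=
    hZi.const_mul 2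
  have h2 : Integrable fun y : ℝ =>
      2 * (‖weilMellin g (1 / 2 + y * I)‖ ^ 2 *
        (∑ n ∈ Finset.Icc 1 N, (n : ℂ) ^ (-(1 / 2 + y * I))).re) :=
    hSi.const_mul 2
  have h4 : Integrable fun y : ℝ => (Real.log π - 1) * ‖weilMellin g (1 / 2 + y * I)‖ ^ 2 :=
    hAi.const_mul _
  have h12 : Integrable fun y : ℝ =>
      2 * (‖weilMellin g (1 / 2 + y * I)‖ ^ 2 * (riemannZeta (1 / 2 + y * I)).re)
        - 2 * (‖weilMellin g (1 / 2 + y * I)‖ ^ 2 *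
            (∑ n ∈ Finset.Icc 1 N, (n : ℂ) ^ (-(1 / 2 + y * I))).re) :=
    h1.sub h2
  have h123 : Integrable fun y : ℝ =>
      2 * (‖weilMellin g (1 / 2 + y * I)‖ ^ 2 * (riemannZeta (1 / 2 + y * I)).re)
        - 2 * (‖weilMellin g (1 / 2 + y * I)‖ ^ 2 *
            (∑ n ∈ Finset.Icc 1 N, (n : ℂ) ^ (-(1 / 2 + y * I))).re)
        - ‖weilMellin g (1 / 2 + y * I)‖ ^ 2 * (Complex.digamma (1 / 4 + y / 2 * I)).re :=
    h12.sub hDi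
  have hsplit : ∫ y : ℝ, ‖weilMellin g (1 / 2 + y * I)‖ ^ 2 *
      (2 * (riemannZeta (1 / 2 + y * I)
            - ∑ n ∈ Finset.Icc 1 N, (n : ℂ) ^ (-(1 / 2 + y * I))).re
        - (Complex.digamma (1 / 4 + y / 2 * I)).re + Real.log π - 1)
      = 2 * (∫ y : ℝ, ‖weilMellin g (1 / 2 + y * I)‖ ^ 2 * (riemannZeta (1 / 2 + y * I)).re)
        - 2 * (∫ y : ℝ, ‖weilMellin g (1 / 2 + y * I)‖ ^ 2 *
            (∑ n ∈ Finset.Icc 1 N, (n : ℂ) ^ (-(1 / 2 + y * I))).re)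
        - (∫ y : ℝ, ‖weilMellin g (1 / 2 + y * I)‖ ^ 2 *
            (Complex.digamma (1 / 4 + y / 2 * I)).re)
        + (Real.log π - 1) * ∫ y : ℝ, ‖weilMellin g (1 / 2 + y * I)‖ ^ 2 := by
    rw [integral_congr_ae (Eventually.of_forall e), integral_add h123 h4, integral_sub h12 hDi,
      integral_sub h1 h2, integral_const_mul, integral_const_mul, integral_const_mul]
  -- assemble (pure algebra in the five real numbers `Re k̂(1)`, `Re Σ k(log n)/√n`, `∫ |ĝ|² Re ψ`,
  -- `‖g‖₂²`; the integrals are generalized so that normalisation does not enter the binders)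
  have hπ : (π : ℝ) ≠ 0 := Real.pi_pos.ne'
  have key : ∀ M S D Q : ℝ,
      2 * M + (1 / (2 * π) * D - Q * Real.log π) + Q
        = -(1 / (2 * π)) * (2 * (2 * π * S - 2 * π * M) - 2 * (2 * π * S) - D
            + (Real.log π - 1) * (2 * π * Q)) := by
    intro M S D Q
    field_simp
    ring
  rw [Complex.add_re, weilPolarTerm_autocorr_re hg, weilArchTerm_autocorr_re hg, hsplit, hZv, hPre,
    hSv, hPl]
  exact key _ _ _ _

end Summit.RiemannHypothesis.RiemannHypothesis.Theorems.SignConeOscillatory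

end
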